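import Literature.Barriers.CriticalPhenomena.LaceExpansionFourier
import Literature.Barriers.CriticalPhenomena.LaceExpansionKernelFourier
import Literature.Barriers.CriticalPhenomena.LaceExpansionCubeSliceIntegrals
import Mathlib.MeasureTheory.Function.LpSeminorm.CompareExp
import Mathlib.MeasureTheory.Integral.MeanInequalities
import HarnessLib

/-!
# `L^p` bookkeeping on the cube `[-π,π]^d` for Liu–Slade's Gaussian deconvolution theorem

Support file (all results proved, no definitions-as-facts) for the proof of the named fact
`SpreadOutIsing.LiuSlade2024_thm12_critical` (Liu–Slade 2024, Theorem 1.2 in the critical case;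
`LaceExpansionIsingDeconvolutionParts.lean`). The printed proof (§2.2 of the source) bounds the
`α`-th weak derivative of `f̂ = Ê/(ÂF̂)` in `L¹(𝕋^d)` by writing it as a linear combination of
products of factors `Â_δ/Â`, `Ê_{α₂}/(ÂF̂)`, `F̂_γ/F̂`, each of which lies in `L^q(𝕋^d)` for every
`q` with `q⁻¹ > c/d` for an explicit "cost" `c` (Lemma 2.5), and applying Hölder's inequality:
the costs add up to `(|α| + 2 - σ)/d < 1` (proof of Proposition 2.4). This file isolates that
bookkeeping as a calculus of function CLASSES on the cube `[-π,π]^d ⊂ ℝ^d` (Lebesgue measure):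

* `LS24.IsWL d t Φ` — a family `Φ = (Φ_i)_{i ∈ ι}` of real functions on `ℝ^d` (in the application
  `i` runs over the admissible data `(F, m)`, so that constants are UNIFORM in the data) is of
  *weak Lebesgue class* `t` if for every real `p ≥ 1` with `t/d < 1/p` the norms
  `‖Φ_i‖_{L^p([-π,π]^d)}` are bounded uniformly in `i`;
* closure under sums, scalar multiples with bounded coefficients, pointwise domination,
  monotonicity in `t`, and PRODUCTS: `IsWL t₁ Φ → IsWL t₂ Ψ → IsWL (t₁ + t₂) (Φ Ψ)` for
  `t₁, t₂ ≥ 0` (Hölder's inequality with `p₁⁻¹ = t₁/d + ε`, `p₂⁻¹ = p⁻¹ - p₁⁻¹`);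
* the basic members: bounded families (`t = 0`) and the shifted power weights
  `k ↦ ‖k + v_i‖^{-s}` with `‖v_i‖ ≤ 1` (`t = s`; polar coordinates in the sup norm, the tree's
  `integrableOn_pi_norm_rpow_neg_ball` of `LaceExpansionCubeSliceIntegrals.lean`), which dominate `1/F̂`, `1/Â` and their
  translates through the infrared bound;
* the interpolation (Lyapunov) inequality `‖g‖_p ≤ ‖g‖_{p₀}^{1-θ} ‖g‖_{p₁}^θ`,
  `p⁻¹ = (1-θ)p₀⁻¹ + θp₁⁻¹`, by which the source's use of the torus Sobolev inequality
  (Lemma 2.10) is replaced in the sequel (the functions to which Lemma 2.10 is applied there all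
  have an explicit pointwise majorant).

## References

* Y. Liu, G. Slade, *Gaussian deconvolution and the lace expansion*, Probab. Theory Related
  Fields (2024), arXiv:2310.07635: §2.2.1 (Lemma 2.5, proof of Proposition 2.4: "By Lemma 2.5 and
  Hölder's inequality, the `L^r` norm of (2.10) is bounded by … where `r⁻¹ = Σ r_n⁻¹ + q⁻¹ + Σ q_m⁻¹
  > (|α| + 2 - σ)/d`"), §2.3.1 (Lemma 2.10) [LiuSlade2024].
-/

noncomputable section

namespace Literature.Barriers.CriticalPhenomena.SpreadOutIsing

namespace LS24

open _root_.MeasureTheory _root_.Filter Real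
open scoped ENNReal NNReal

variable {d : ℕ} {ι : Type*}

/-- **The weak Lebesgue classes.** A family `Φ = (Φ_i)` of real functions on `ℝ^d` is of class
`t` on the cube if each `Φ_i` is a.e. strongly measurable on `[-π,π]^d` and, for every real
`p ≥ 1` with `t/d < 1/p`, `sup_i ‖Φ_i‖_{L^p([-π,π]^d)} < ∞`. (For `t < d` this says
`Φ_i ∈ L^p` uniformly for all `p < d/t`; the source's factors `F̂_γ/F̂ ∈ L^q (q⁻¹ > |γ|/d)`,
`Ê_γ/(ÂF̂) ∈ L^q (q⁻¹ > (2 - σ + |γ|)/d)` of Lemma 2.5 are the classes `t = |γ|`,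
`t = 2 - σ + |γ|`.) [cite: LiuSlade2024, Lemma 2.5 with (2.12)] -/
structure IsWL (d : ℕ) (t : ℝ) (Φ : ι → (Fin d → ℝ) → ℝ) : Prop where
  aestronglyMeasurable : ∀ i, AEStronglyMeasurable (Φ i) (volume.restrict (cube d))
  bound : ∀ p : ℝ, 1 ≤ p → t / d < 1 / p →
    ∃ C : ℝ≥0, ∀ i, eLpNorm (Φ i) (ENNReal.ofReal p) (volume.restrict (cube d)) ≤ C

/-- The zero family is of every class. [folklore] -/
theorem isWL_zero (d : ℕ) (t : ℝ) : IsWL d t (fun (_ : ι) (_ : Fin d → ℝ) => (0 : ℝ)) :=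
  ⟨fun _ => aestronglyMeasurable_const, fun _ _ _ => ⟨0, fun _ => by simp⟩⟩

namespace IsWL

variable {t t₁ t₂ : ℝ} {Φ Ψ : ι → (Fin d → ℝ) → ℝ}

/-- Monotonicity in the class parameter: a larger `t` is a weaker requirement. [folklore] -/
theorem mono (h : IsWL d t₁ Φ) (ht : t₁ ≤ t₂) : IsWL d t₂ Φ := by
  refine ⟨h.aestronglyMeasurable, fun p hp htp => h.bound p hp (lt_of_le_of_lt ?_ htp)⟩
  exact div_le_div_of_nonneg_right ht (Nat.cast_nonneg d)

/-- Pointwise domination `|Ψ_i| ≤ c |Φ_i|` on the cube (uniform `c`) transports the class.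
[folklore] -/
theorem of_le (h : IsWL d t Φ) (hΨ : ∀ i, AEStronglyMeasurable (Ψ i) (volume.restrict (cube d))) {c : ℝ}
    (hle : ∀ i, ∀ k ∈ cube d, |Ψ i k| ≤ c * |Φ i k|) : IsWL d t Ψ := by
  refine ⟨hΨ, fun p hp htp => ?_⟩
  obtain ⟨C, hC⟩ := h.bound p hp htp
  refine ⟨Real.toNNReal |c| * C, fun i => ?_⟩
  have hae : ∀ᵐ k ∂volume.restrict (cube d), ‖Ψ i k‖ ≤ |c| * ‖Φ i k‖ := by
    rw [ae_restrict_iff' (measurableSet_cube d)]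
    refine ae_of_all _ fun k hk => ?_
    rw [Real.norm_eq_abs, Real.norm_eq_abs]
    exact (hle i k hk).trans (mul_le_mul_of_nonneg_right (le_abs_self c) (abs_nonneg _))
  calc eLpNorm (Ψ i) (ENNReal.ofReal p) (volume.restrict (cube d))
      ≤ ENNReal.ofReal |c| * eLpNorm (Φ i) (ENNReal.ofReal p) (volume.restrict (cube d)) :=
        eLpNorm_le_mul_eLpNorm_of_ae_le_mul hae (ENNReal.ofReal p)
    _ ≤ ENNReal.ofReal |c| * C := by gcongr; exact hC i
    _ = ((Real.toNNReal |c| * C : ℝ≥0) : ℝ≥0∞) := by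
        rw [ENNReal.coe_mul, ENNReal.ofReal]

/-- Negation. [folklore] -/
theorem neg (h : IsWL d t Φ) : IsWL d t (fun i k => -Φ i k) := by
  refine ⟨fun i => (h.aestronglyMeasurable i).neg, fun p hp htp => ?_⟩
  obtain ⟨C, hC⟩ := h.bound p hp htp
  exact ⟨C, fun i => by rw [show (fun k => -Φ i k) = -Φ i from rfl, eLpNorm_neg]; exact hC i⟩

/-- Sums (of two families of the same class). [folklore] -/
theorem add (h₁ : IsWL d t Φ) (h₂ : IsWL d t Ψ) : IsWL d t (fun i k => Φ i k + Ψ i k) := by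
  refine ⟨fun i => (h₁.aestronglyMeasurable i).add (h₂.aestronglyMeasurable i), fun p hp htp => ?_⟩
  obtain ⟨C₁, hC₁⟩ := h₁.bound p hp htp
  obtain ⟨C₂, hC₂⟩ := h₂.bound p hp htp
  refine ⟨C₁ + C₂, fun i => ?_⟩
  have hp1 : (1 : ℝ≥0∞) ≤ ENNReal.ofReal p := by
    rw [← ENNReal.ofReal_one]; exact ENNReal.ofReal_le_ofReal hp
  calc eLpNorm (fun k => Φ i k + Ψ i k) (ENNReal.ofReal p) (volume.restrict (cube d))
      = eLpNorm (Φ i + Ψ i) (ENNReal.ofReal p) (volume.restrict (cube d)) := rfl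
    _ ≤ eLpNorm (Φ i) (ENNReal.ofReal p) (volume.restrict (cube d)) +
          eLpNorm (Ψ i) (ENNReal.ofReal p) (volume.restrict (cube d)) :=
        eLpNorm_add_le (h₁.aestronglyMeasurable i) (h₂.aestronglyMeasurable i) hp1
    _ ≤ C₁ + C₂ := add_le_add (hC₁ i) (hC₂ i)
    _ = ((C₁ + C₂ : ℝ≥0) : ℝ≥0∞) := (ENNReal.coe_add _ _).symm

/-- Differences. [folklore] -/
theorem sub (h₁ : IsWL d t Φ) (h₂ : IsWL d t Ψ) : IsWL d t (fun i k => Φ i k - Ψ i k) := by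
  have := h₁.add h₂.neg
  simpa [sub_eq_add_neg] using this

/-- Scalar multiples with coefficients bounded uniformly in the index. [folklore] -/
theorem const_mul (h : IsWL d t Φ) {c : ι → ℝ} {M : ℝ} (hc : ∀ i, |c i| ≤ M) :
    IsWL d t (fun i k => c i * Φ i k) := by
  refine h.of_le (fun i => (h.aestronglyMeasurable i).const_mul (c i)) (c := M) fun i k _ => ?_
  rw [abs_mul]
  exact mul_le_mul_of_nonneg_right (hc i) (abs_nonneg _)

/-- Finite sums `Σ_{j ∈ s} Φ^{(j)}` of families of the same class. [folklore] -/
theorem finset_sum {κ : Type*} (s : Finset κ) {Φ : κ → ι → (Fin d → ℝ) → ℝ}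
    (h : ∀ j ∈ s, IsWL d t (Φ j)) : IsWL d t (fun i k => ∑ j ∈ s, Φ j i k) := by
  classical
  induction s using Finset.induction_on with
  | empty => simpa using isWL_zero (ι := ι) d t
  | insert a s ha ih =>
    have h1 : IsWL d t (Φ a) := h a (Finset.mem_insert_self a s)
    have h2 := ih fun j hj => h j (Finset.mem_insert_of_mem hj)
    have := h1.add h2
    simpa [Finset.sum_insert ha] using this

end IsWL

/-- **Bounded families are of class `0`** (hence of every class `t ≥ 0`): if `|Φ_i| ≤ M` on the
cube then `‖Φ_i‖_p ≤ M (2π)^{d/p}`. [folklore] -/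
theorem isWL_of_bounded {Φ : ι → (Fin d → ℝ) → ℝ}
    (hΦ : ∀ i, AEStronglyMeasurable (Φ i) (volume.restrict (cube d))) {M : ℝ}
    (hle : ∀ i, ∀ k ∈ cube d, |Φ i k| ≤ M) {t : ℝ} (ht : 0 ≤ t) : IsWL d t Φ := by
  refine IsWL.mono ?_ ht
  refine ⟨hΦ, fun p hp _ => ?_⟩
  refine ⟨(ENNReal.ofReal M * volume.restrict (cube d) Set.univ ^ (1 / p)).toNNReal, fun i => ?_⟩
  have hae : ∀ᵐ k ∂volume.restrict (cube d), ‖Φ i k‖ ≤ M := by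
    rw [ae_restrict_iff' (measurableSet_cube d)]
    exact ae_of_all _ fun k hk => by rw [Real.norm_eq_abs]; exact hle i k hk
  have h := eLpNorm_le_of_ae_bound (p := ENNReal.ofReal p) hae
  have hfin : ENNReal.ofReal M * volume.restrict (cube d) Set.univ ^ (1 / p) ≠ ∞ := by
    refine ENNReal.mul_ne_top ENNReal.ofReal_ne_top ?_
    refine ENNReal.rpow_ne_top_of_nonneg (by positivity) ?_
    rw [LaceExpansion.volume_restrict_cube_eq]
    exact measure_ne_top _ _
  rw [ENNReal.coe_toNNReal hfin]
  refine h.trans (le_of_eq ?_)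
  rw [ENNReal.toReal_ofReal (by linarith), mul_comm, one_div]

/-! ### Products: Hölder's inequality -/

/-- A Hölder triple `(p₁, p₂, p)` in `ℝ≥0∞` from the real identity `1/p₁ + 1/p₂ = 1/p`.
[folklore] -/
theorem holderTriple_ofReal {p₁ p₂ p : ℝ} (hp₁ : 0 < p₁) (hp₂ : 0 < p₂) (hp : 0 < p)
    (h : 1 / p₁ + 1 / p₂ = 1 / p) :
    ENNReal.HolderTriple (ENNReal.ofReal p₁) (ENNReal.ofReal p₂) (ENNReal.ofReal p) := by
  refine ⟨?_⟩
  rw [← ENNReal.ofReal_inv_of_pos hp₁, ← ENNReal.ofReal_inv_of_pos hp₂,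
    ← ENNReal.ofReal_inv_of_pos hp, ← ENNReal.ofReal_add (by positivity) (by positivity)]
  congr 1
  simpa only [one_div] using h

/-- The exponent split behind the product rule: given `p ≥ 1` with `(t₁ + t₂)/d < 1/p` and
`t₁, t₂ ≥ 0`, there are `p₁, p₂ ≥ 1` with `1/p₁ + 1/p₂ = 1/p`, `t₁/d < 1/p₁`, `t₂/d < 1/p₂`.
[folklore] -/
theorem exists_exponent_split {t₁ t₂ p : ℝ} (hd : 0 < (d : ℝ)) (ht₁ : 0 ≤ t₁) (ht₂ : 0 ≤ t₂)
    (hp : 1 ≤ p) (h : (t₁ + t₂) / d < 1 / p) :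
    ∃ p₁ p₂ : ℝ, 1 ≤ p₁ ∧ 1 ≤ p₂ ∧ 1 / p₁ + 1 / p₂ = 1 / p ∧ t₁ / d < 1 / p₁ ∧ t₂ / d < 1 / p₂ := by
  have hp0 : 0 < p := by linarith
  set ε : ℝ := (1 / p - (t₁ + t₂) / d) / 2 with hε
  have hεpos : 0 < ε := by rw [hε]; linarith
  set θ₁ : ℝ := t₁ / d + ε with hθ₁
  set θ₂ : ℝ := 1 / p - θ₁ with hθ₂
  have hθ₁pos : 0 < θ₁ := by
    have : 0 ≤ t₁ / d := div_nonneg ht₁ hd.le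
    rw [hθ₁]; linarith
  have hθ₂eq : θ₂ = t₂ / d + ε := by
    rw [hθ₂, hθ₁, hε, add_div]; ring
  have hθ₂pos : 0 < θ₂ := by
    have : 0 ≤ t₂ / d := div_nonneg ht₂ hd.le
    rw [hθ₂eq]; linarith
  have hsum : θ₁ + θ₂ = 1 / p := by rw [hθ₂]; ring
  have hple : 1 / p ≤ 1 := by
    rw [div_le_one hp0]; exact hp
  have hθ₁le : θ₁ ≤ 1 := by linarith
  have hθ₂le : θ₂ ≤ 1 := by linarith
  refine ⟨1 / θ₁, 1 / θ₂, ?_, ?_, ?_, ?_, ?_⟩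
  · rw [le_div_iff₀ hθ₁pos, one_mul]; exact hθ₁le
  · rw [le_div_iff₀ hθ₂pos, one_mul]; exact hθ₂le
  · rw [one_div_one_div, one_div_one_div, hsum]
  · rw [one_div_one_div, hθ₁]; linarith
  · rw [one_div_one_div, hθ₂eq]; linarith

/-- **The product rule of the bookkeeping (Hölder's inequality)**: classes add under pointwise
products, `IsWL t₁ Φ → IsWL t₂ Ψ → IsWL (t₁ + t₂) (Φ Ψ)` for `t₁, t₂ ≥ 0` (given `p` with
`(t₁+t₂)/d < 1/p`, split `1/p = 1/p₁ + 1/p₂` with `tᵢ/d < 1/pᵢ` and apply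
`‖Φ_i Ψ_i‖_p ≤ ‖Φ_i‖_{p₁} ‖Ψ_i‖_{p₂}`). This is the step "By Lemma 2.5 and Hölder's inequality,
the `L^r` norm of (2.10) is bounded by …" of the source.
[cite: LiuSlade2024, proof of Proposition 2.4 (§2.2.1)] -/
theorem IsWL.mul {t₁ t₂ : ℝ} {Φ Ψ : ι → (Fin d → ℝ) → ℝ} (hd : 0 < d) (ht₁ : 0 ≤ t₁) (ht₂ : 0 ≤ t₂)
    (h₁ : IsWL d t₁ Φ) (h₂ : IsWL d t₂ Ψ) : IsWL d (t₁ + t₂) (fun i k => Φ i k * Ψ i k) := by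
  have hdR : 0 < (d : ℝ) := by exact_mod_cast hd
  refine ⟨fun i => (h₁.aestronglyMeasurable i).mul (h₂.aestronglyMeasurable i), fun p hp htp => ?_⟩
  obtain ⟨p₁, p₂, hp₁, hp₂, hsum, hlt₁, hlt₂⟩ := exists_exponent_split hdR ht₁ ht₂ hp htp
  obtain ⟨C₁, hC₁⟩ := h₁.bound p₁ hp₁ hlt₁
  obtain ⟨C₂, hC₂⟩ := h₂.bound p₂ hp₂ hlt₂
  haveI := holderTriple_ofReal (by linarith) (by linarith) (by linarith) hsum
  refine ⟨C₁ * C₂, fun i => ?_⟩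
  have h := eLpNorm_le_eLpNorm_mul_eLpNorm_of_nnnorm (μ := volume.restrict (cube d))
    (p := ENNReal.ofReal p₁) (q := ENNReal.ofReal p₂) (r := ENNReal.ofReal p)
    (h₁.aestronglyMeasurable i) (h₂.aestronglyMeasurable i) (fun a b : ℝ => a * b) 1
    (ae_of_all _ fun k => by simp)
  calc eLpNorm (fun k => Φ i k * Ψ i k) (ENNReal.ofReal p) (volume.restrict (cube d))
      ≤ (1 : ℝ≥0) * eLpNorm (Φ i) (ENNReal.ofReal p₁) (volume.restrict (cube d)) *
          eLpNorm (Ψ i) (ENNReal.ofReal p₂) (volume.restrict (cube d)) := h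
    _ ≤ (1 : ℝ≥0) * C₁ * C₂ := by gcongr <;> first | exact hC₁ i | exact hC₂ i
    _ = ((C₁ * C₂ : ℝ≥0) : ℝ≥0∞) := by push_cast; ring

/-- Finite products `Π_{j ∈ s} Φ^{(j)}` with `IsWL (t j) Φ^{(j)}`, `t j ≥ 0`, are of class
`Σ_{j ∈ s} t j`. [cite: LiuSlade2024, proof of Proposition 2.4 (§2.2.1)] -/
theorem IsWL.finset_prod {κ : Type*} (hd : 0 < d) (s : Finset κ) {Φ : κ → ι → (Fin d → ℝ) → ℝ}
    {t : κ → ℝ} (ht : ∀ j ∈ s, 0 ≤ t j) (h : ∀ j ∈ s, IsWL d (t j) (Φ j)) :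
    IsWL d (∑ j ∈ s, t j) (fun i k => ∏ j ∈ s, Φ j i k) := by
  classical
  induction s using Finset.induction_on with
  | empty =>
    simp only [Finset.sum_empty, Finset.prod_empty]
    exact isWL_of_bounded (fun _ => aestronglyMeasurable_const) (M := 1)
      (fun _ _ _ => by simp) le_rfl
  | insert a s ha ih =>
    have h1 : IsWL d (t a) (Φ a) := h a (Finset.mem_insert_self a s)
    have h2 := ih (fun j hj => ht j (Finset.mem_insert_of_mem hj))
      (fun j hj => h j (Finset.mem_insert_of_mem hj))
    have hs : 0 ≤ ∑ j ∈ s, t j := Finset.sum_nonneg fun j hj => ht j (Finset.mem_insert_of_mem hj)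
    have := h1.mul hd (ht a (Finset.mem_insert_self a s)) hs h2
    simpa [Finset.sum_insert ha, Finset.prod_insert ha] using this


/-! ### `L¹` bounds and the basic members -/

/-- **`L¹` bounds from the class**: if `IsWL t Φ` with `t < d` then the `Φ_i` are integrable on
the cube with `∫_{[-π,π]^d} |Φ_i| ≤ C` uniformly in `i` (the exponent `p = 1`; the source's "We can
take `r = 1` because `|α| ≤ n_d < d - 2 + ρ ∧ 2`"). [cite: LiuSlade2024, proof of Proposition 2.4 (§2.2.1)] -/
theorem IsWL.exists_integral_le {t : ℝ} {Φ : ι → (Fin d → ℝ) → ℝ} (h : IsWL d t Φ) (hd : 0 < d)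
    (ht : t < d) :
    ∃ C : ℝ, ∀ i, Integrable (Φ i) (volume.restrict (cube d)) ∧ ∫ k in cube d, |Φ i k| ≤ C := by
  have hdR : 0 < (d : ℝ) := by exact_mod_cast hd
  obtain ⟨C, hC⟩ := h.bound 1 le_rfl (by rw [div_lt_iff₀ hdR]; linarith)
  refine ⟨C, fun i => ?_⟩
  have h1 : eLpNorm (Φ i) 1 (volume.restrict (cube d)) ≤ C := by simpa using hC i
  rw [eLpNorm_one_eq_lintegral_enorm] at h1
  have hint : Integrable (Φ i) (volume.restrict (cube d)) :=
    ⟨h.aestronglyMeasurable i, (hasFiniteIntegral_iff_enorm).2 (h1.trans_lt ENNReal.coe_lt_top)⟩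
  refine ⟨hint, ?_⟩
  have h2 : ∫ k in cube d, |Φ i k| = (∫⁻ k, ‖Φ i k‖ₑ ∂volume.restrict (cube d)).toReal := by
    rw [← integral_norm_eq_lintegral_enorm (h.aestronglyMeasurable i)]
    rfl
  rw [h2]
  exact ENNReal.toReal_le_coe_of_le_coe h1

/-- The translate `[-π,π]^d - v` of the cube by a vector with `‖v‖ ≤ 1` lies in the ball of radius
`π + 2`. [folklore] -/
theorem sub_mem_ball_of_mem_cube {k v : Fin d → ℝ} (hk : k + v ∈ cube d) (hv : ‖v‖ ≤ 1) :
    k ∈ Metric.ball (0 : Fin d → ℝ) (π + 2) := by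
  have h1 := cube_subset_ball d hk
  rw [Metric.mem_ball, dist_zero_right] at h1 ⊢
  calc ‖k‖ = ‖(k + v) - v‖ := by rw [add_sub_cancel_right]
    _ ≤ ‖k + v‖ + ‖v‖ := norm_sub_le _ _
    _ < π + 1 + 1 := add_lt_add_of_lt_of_le h1 hv
    _ = π + 2 := by ring

/-- **Shifted power weights**: for `s ≥ 0` and shifts `‖v_i‖ ≤ 1`, the family
`k ↦ ‖k + v_i‖^{-s}` (sup norm) is of class `s`: for `sp < d`,
`∫_{[-π,π]^d} ‖k + v_i‖^{-sp} dk ≤ ∫_{‖k‖ < π+2} ‖k‖^{-sp} dk < ∞`. Through the infrared bounds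
`F̂(k) ≥ K₂|k|²`, `Â(k) ≥ c|k|²` these dominate `1/F̂`, `1/Â` and their translates by `±u e_j`
(the source's `‖1/|k|²‖_p < ∞ (p⁻¹ > 2/d)`, `‖|k ± u|^{-η}‖_{r₁}‖|k ± u|^{-2}‖_{r₂}`).
[cite: LiuSlade2024, proof of Lemma 2.5 (§2.2.2) and of Lemma 2.12 (§2.3.3)] -/
theorem isWL_norm_add_rpow_neg (hd : 1 ≤ d) (s : ℝ) {v : ι → Fin d → ℝ}
    (hv : ∀ i, ‖v i‖ ≤ 1) : IsWL d s (fun i k => ‖k + v i‖ ^ (-s)) := by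
  have hdR : 0 < (d : ℝ) := by exact_mod_cast (show 0 < d by omega)
  have hmeas : ∀ w : Fin d → ℝ, Measurable fun k : Fin d → ℝ => ‖k + w‖ ^ (-s) := fun w => by
    fun_prop
  refine ⟨fun i => (hmeas (v i)).aestronglyMeasurable, fun p hp hsp => ?_⟩
  have hp0 : 0 < p := by linarith
  have hspd : s * p < d := by
    rw [div_lt_div_iff₀ hdR hp0, ] at hsp; linarith
  -- the dominating integral over the ball
  set B : Set (Fin d → ℝ) := Metric.ball 0 (π + 2) with hB
  have hint : IntegrableOn (fun k : Fin d → ℝ => ‖k‖ ^ (-(s * p))) B :=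
    integrableOn_pi_norm_rpow_neg_ball hd hspd _
  set J : ℝ≥0∞ := ∫⁻ k in B, ENNReal.ofReal (‖k‖ ^ (-(s * p))) with hJ
  have hJfin : J ≠ ∞ := by
    rw [hJ, ← ofReal_integral_eq_lintegral_ofReal hint
      (ae_of_all _ fun k => Real.rpow_nonneg (norm_nonneg k) _)]
    exact ENNReal.ofReal_ne_top
  refine ⟨(J ^ (1 / p)).toNNReal, fun i => ?_⟩
  rw [ENNReal.coe_toNNReal (ENNReal.rpow_ne_top_of_nonneg (by positivity) hJfin)]
  have hpne : ENNReal.ofReal p ≠ 0 := by simpa using hp0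
  rw [eLpNorm_eq_lintegral_rpow_enorm_toReal hpne ENNReal.ofReal_ne_top,
    ENNReal.toReal_ofReal hp0.le]
  gcongr
  -- pointwise identity of the integrands
  have hpt : ∀ k : Fin d → ℝ, (‖‖k‖ ^ (-s)‖ₑ : ℝ≥0∞) ^ p = ENNReal.ofReal (‖k‖ ^ (-(s * p))) := by
    intro k
    rw [Real.enorm_eq_ofReal (Real.rpow_nonneg (norm_nonneg k) _),
      ENNReal.ofReal_rpow_of_nonneg (Real.rpow_nonneg (norm_nonneg k) _) hp0.le,
      ← Real.rpow_mul (norm_nonneg k), neg_mul]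
  -- change of variables `k ↦ k + v i` and monotonicity in the domain
  have hcov : ∫⁻ k in cube d, (‖‖k + v i‖ ^ (-s)‖ₑ : ℝ≥0∞) ^ p =
      ∫⁻ k in (fun k => k + v i) '' cube d, (‖‖k‖ ^ (-s)‖ₑ : ℝ≥0∞) ^ p := by
    have hmp : MeasurePreserving (fun k : Fin d → ℝ => k + v i) volume volume :=
      measurePreserving_add_right volume (v i)
    exact hmp.setLIntegral_comp_emb (MeasurableEquiv.addRight (v i)).measurableEmbedding
      (fun k => (‖‖k‖ ^ (-s)‖ₑ : ℝ≥0∞) ^ p) (cube d)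
  have hsub : (fun k => k + v i) '' cube d ⊆ B := by
    rintro _ ⟨k, hk, rfl⟩
    refine sub_mem_ball_of_mem_cube (v := -v i) ?_ (by rw [norm_neg]; exact hv i)
    simpa using hk
  calc ∫⁻ k, (‖‖k + v i‖ ^ (-s)‖ₑ : ℝ≥0∞) ^ p ∂volume.restrict (cube d)
      = ∫⁻ k in (fun k => k + v i) '' cube d, (‖‖k‖ ^ (-s)‖ₑ : ℝ≥0∞) ^ p := hcov
    _ ≤ ∫⁻ k in B, (‖‖k‖ ^ (-s)‖ₑ : ℝ≥0∞) ^ p := lintegral_mono_set hsub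
    _ = J := by rw [hJ]; exact lintegral_congr fun k => hpt k

/-! ### Translation invariance for periodic functions -/

/-- **Translation invariance**: for a measurable `Φ` that is `2π`-periodic in every coordinate,
`‖Φ(· + v)‖_{L^p([-π,π]^d)} = ‖Φ‖_{L^p([-π,π]^d)}` (`0 < p < ∞`; the tree's
`LaceExpansion.lintegral_cube_comp_add` applied to `|Φ|^p`). In the source this is the silent
step by which the shifted factors `(Ê_γ/Â)(k + u)`, `(F̂_γ/F̂)(k - u)` of (2.43), (2.54) keep the
`L^q` bounds of the unshifted ones. [cite: LiuSlade2024, proof of Lemma 2.12 (§2.3.3)] -/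
theorem eLpNorm_comp_add_eq_of_periodic {Φ : (Fin d → ℝ) → ℝ} (hΦ : Measurable Φ)
    (hper : ∀ (k : Fin d → ℝ) (n : Fin d → ℤ), Φ (fun j => k j + 2 * π * n j) = Φ k)
    (v : Fin d → ℝ) {p : ℝ} (hp : 0 < p) :
    eLpNorm (fun k => Φ (k + v)) (ENNReal.ofReal p) (volume.restrict (cube d)) =
      eLpNorm Φ (ENNReal.ofReal p) (volume.restrict (cube d)) := by
  have hpne : ENNReal.ofReal p ≠ 0 := by simpa using hp
  rw [eLpNorm_eq_lintegral_rpow_enorm_toReal hpne ENNReal.ofReal_ne_top,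
    eLpNorm_eq_lintegral_rpow_enorm_toReal hpne ENNReal.ofReal_ne_top, ENNReal.toReal_ofReal hp.le]
  congr 1
  have h := LaceExpansion.lintegral_cube_comp_add (fun k => (‖Φ k‖ₑ : ℝ≥0∞) ^ p)
    (by fun_prop) (fun l n => by simp only [hper l n]) v
  simpa using h

/-- Translation of a periodic family by index-dependent vectors preserves its class.
[cite: LiuSlade2024, proof of Lemma 2.12 (§2.3.3)] -/
theorem IsWL.comp_add {t : ℝ} {Φ : ι → (Fin d → ℝ) → ℝ} (h : IsWL d t Φ)
    (hΦ : ∀ i, Measurable (Φ i))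
    (hper : ∀ i (k : Fin d → ℝ) (n : Fin d → ℤ), Φ i (fun j => k j + 2 * π * n j) = Φ i k)
    (v : ι → Fin d → ℝ) : IsWL d t (fun i k => Φ i (k + v i)) := by
  refine ⟨fun i => ((hΦ i).comp (measurable_id.add_const (v i))).aestronglyMeasurable,
    fun p hp htp => ?_⟩
  obtain ⟨C, hC⟩ := h.bound p hp htp
  exact ⟨C, fun i => by rw [eLpNorm_comp_add_eq_of_periodic (hΦ i) (hper i) (v i) (by linarith)]; exact hC i⟩

/-! ### Interpolation between two exponents -/

/-- **Lyapunov's inequality** (log-convexity of `p ↦ ‖g‖_p`): for `0 < θ < 1` and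
`1/p = (1-θ)/p₀ + θ/p₁`, `‖g‖_p ≤ ‖g‖_{p₀}^{1-θ} ‖g‖_{p₁}^θ` (Hölder's inequality applied to
`|g| = |g|^{1-θ} · |g|^θ` with exponents `p₀/(1-θ)`, `p₁/θ`). It replaces, in the sequel, the
interpolation step "`‖U_u g‖_{p_η} ≤ ‖U_u g‖_p^η ‖U_u g‖_{p*}^{1-η}` by the log-convexity of `L^p`
norms" of the proof of Lemma 2.10 of the source. [cite: LiuSlade2024, proof of Lemma 2.10 (§2.3.1)] -/
theorem eLpNorm_le_eLpNorm_rpow_mul_eLpNorm_rpow {α : Type*} [MeasurableSpace α] {μ : Measure α}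
    {g : α → ℝ} (hg : AEStronglyMeasurable g μ) {p₀ p₁ p θ : ℝ} (hp₀ : 0 < p₀) (hp₁ : 0 < p₁)
    (hp : 0 < p) (hθ0 : 0 < θ) (hθ1 : θ < 1) (h : 1 / p = (1 - θ) / p₀ + θ / p₁) :
    eLpNorm g (ENNReal.ofReal p) μ ≤
      eLpNorm g (ENNReal.ofReal p₀) μ ^ (1 - θ) * eLpNorm g (ENNReal.ofReal p₁) μ ^ θ := by
  have h1θ : 0 < 1 - θ := by linarith
  -- the two factors
  set G₀ : α → ℝ := fun x => ‖g x‖ ^ (1 - θ) with hG₀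
  set G₁ : α → ℝ := fun x => ‖g x‖ ^ θ with hG₁
  have hG₀m : AEStronglyMeasurable G₀ μ := hg.norm.aemeasurable.pow_const _ |>.aestronglyMeasurable
  have hG₁m : AEStronglyMeasurable G₁ μ := hg.norm.aemeasurable.pow_const _ |>.aestronglyMeasurable
  -- Hölder exponents
  haveI : ENNReal.HolderTriple (ENNReal.ofReal (p₀ / (1 - θ))) (ENNReal.ofReal (p₁ / θ))
      (ENNReal.ofReal p) :=
    holderTriple_ofReal (by positivity) (by positivity) hp (by
      rw [h, one_div_div, one_div_div])
  have hprod : eLpNorm g (ENNReal.ofReal p) μ = eLpNorm (fun x => G₀ x * G₁ x) (ENNReal.ofReal p) μ := by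
    rw [← eLpNorm_norm g]
    refine eLpNorm_congr_ae (ae_of_all _ fun x => ?_)
    simp only [hG₀, hG₁]
    rcases eq_or_lt_of_le (norm_nonneg (g x)) with h0 | h0
    · rw [← h0, Real.zero_rpow h1θ.ne', zero_mul]
    · rw [← Real.rpow_add h0]; norm_num
  have hH := eLpNorm_le_eLpNorm_mul_eLpNorm_of_nnnorm (μ := μ)
    (p := ENNReal.ofReal (p₀ / (1 - θ))) (q := ENNReal.ofReal (p₁ / θ)) (r := ENNReal.ofReal p)
    hG₀m hG₁m (fun a b : ℝ => a * b) 1 (ae_of_all _ fun k => by simp)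
  have h0 : eLpNorm G₀ (ENNReal.ofReal (p₀ / (1 - θ))) μ = eLpNorm g (ENNReal.ofReal p₀) μ ^ (1 - θ) := by
    rw [hG₀, eLpNorm_norm_rpow g h1θ, ← ENNReal.ofReal_mul (by positivity),
      div_mul_cancel₀ _ h1θ.ne']
  have h1 : eLpNorm G₁ (ENNReal.ofReal (p₁ / θ)) μ = eLpNorm g (ENNReal.ofReal p₁) μ ^ θ := by
    rw [hG₁, eLpNorm_norm_rpow g hθ0, ← ENNReal.ofReal_mul (by positivity),
      div_mul_cancel₀ _ hθ0.ne']
  rw [hprod]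
  calc eLpNorm (fun x => G₀ x * G₁ x) (ENNReal.ofReal p) μ
      ≤ (1 : ℝ≥0) * eLpNorm G₀ (ENNReal.ofReal (p₀ / (1 - θ))) μ * eLpNorm G₁ (ENNReal.ofReal (p₁ / θ)) μ := hH
    _ = eLpNorm g (ENNReal.ofReal p₀) μ ^ (1 - θ) * eLpNorm g (ENNReal.ofReal p₁) μ ^ θ := by
        rw [h0, h1]; simp

end LS24

end Literature.Barriers.CriticalPhenomena.SpreadOutIsing
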